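import Summits.ResolutionOfSingularities.ResolutionOfSingularities.Theorems.SoloBlindFrobeniusSandwich
import Literature.AlgebraicGeometry.Resolution.AlterationsProofs
import Mathlib.AlgebraicGeometry.Morphisms.Finite
import HarnessLib
import HarnessLib.Audit.Tags

/-!
# Lemma R of the Frobenius-sandwich reduction: resolve and compose

This file discharges the obligation node `SoloBlind.ResolveStep` of
`Theorems/SoloBlindFrobeniusSandwich.lean` (solo-blind line, Theorem A):

**Lemma R.** Let `ρ : Z → X` be a purely inseparable alteration of exponent `q` between integral
schemes (`IsPurelyInseparableAlterationOfExponent q ρ`: proper, surjective, and finite with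
`𝒪_Z^q ⊆ 𝒪_X` on sections over a dense open `U ⊆ X`) and let `σ : Z' → Z` be a resolution of
singularities of `Z` (proper, birational, `Z'` regular). Then `Z'` is integral and `σ ≫ ρ` is
again a purely inseparable alteration of exponent `q`.

Proof. `Z'` is reduced (regular) and irreducible (birational onto the irreducible `Z`), so
integral; `σ` is then dominant and proper, hence surjective. Let `V ⊆ Z` be the dense open over
which `σ` is an isomorphism and put `W := U ∖ ρ(Z ∖ V)`, open because `ρ` is closed (proper).
`W` contains the generic point `η_X`: a point of `ρ⁻¹(U)` over `η_X` is the generic point of `Z`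
(the fibre of the finite `ρ ∣_ U` is discrete and `η_Z` specialises to each of its points;
`eq_genericPoint_of_isFinite_restrict`), and `η_Z ∈ V`. Over `W` the composite is
`σ ∣_ ρ⁻¹(W) ≫ ρ ∣_ W` with the first factor an isomorphism (as `ρ⁻¹ W ⊆ V`) and the second
finite of exponent `q` (as `W ⊆ U`); isomorphisms have exponent `1` and exponents multiply under
composition.

Besides the main theorem the file proves the elementary API for the section-level exponent
notion `IsPurelyInseparableOfExponent` needed here and by the remaining nodes: multiplicativity
under composition, exponent `1` for isomorphisms, and the description of the exponent condition
for a restriction `f ∣_ U` in terms of `f.app` on the opens `V ≤ U` (hence its monotonicity in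
`U`).

References: [cite: Temkin2013, §1 p. 3, (i) ⊂ (iii) (a desingularisation is a purely inseparable
alteration; composition bookkeeping)] [cite: DeJong1996, 2.20 (composition of alterations: the
open `U ∖ φ(X' ∖ V)`)] [cite: Ekedahl1987, §1 (height / exponent of a purely inseparable
morphism)]
-/

noncomputable section

open CategoryTheory AlgebraicGeometry TopologicalSpace
open Literature.AlgebraicGeometry.Resolution

namespace Summit.ResolutionOfSingularities.ResolutionOfSingularities.Theorems

universe u

/-! ## API for the section-level exponent -/

/-- Exponents multiply under composition: if `𝒪_X^{q₁} ⊆ 𝒪_Y` along `f` and `𝒪_Y^{q₂} ⊆ 𝒪_Z`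
along `g` (on sections), then `𝒪_X^{q₁ q₂} ⊆ 𝒪_Z` along `f ≫ g`. [folklore] -/
theorem SoloBlind.exponent_comp {X Y Z : Scheme.{u}} {f : X ⟶ Y} {g : Y ⟶ Z} {q₁ q₂ : ℕ}
    (hf : IsPurelyInseparableOfExponent q₁ f) (hg : IsPurelyInseparableOfExponent q₂ g) :
    IsPurelyInseparableOfExponent (q₁ * q₂) (f ≫ g) := by
  intro V a
  obtain ⟨b, hb⟩ := hf (g ⁻¹ᵁ V) a
  obtain ⟨c, hc⟩ := hg V b
  refine ⟨c, ?_⟩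
  rw [Scheme.Hom.comp_app]
  show f.app (g ⁻¹ᵁ V) (g.app V c) = a ^ (q₁ * q₂)
  rw [hc, map_pow, hb, ← pow_mul]
  rfl

/-- An isomorphism is purely inseparable of exponent `1` (all `f.app V` are bijective).
[folklore] -/
theorem SoloBlind.exponent_one_of_isIso {X Y : Scheme.{u}} (f : X ⟶ Y) [IsIso f] :
    IsPurelyInseparableOfExponent 1 f := by
  rw [isPurelyInseparableOfExponent_one_iff]
  intro V a
  haveI : IsIso (f.app V) :=
    f.isIso_app V (by rw [Scheme.Hom.opensRange_of_isIso]; exact le_top)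
  obtain ⟨b, hb⟩ := (asIso (f.app V)).commRingCatIsoToRingEquiv.surjective a
  exact ⟨b, hb⟩

/-- Transport of the exponent condition along an equality of opens `V' = f ⁻¹ V`, from `f.app`
to `f.appLE`. [folklore] -/
theorem SoloBlind.exponent_appLE_of_eq {X Y : Scheme.{u}} (f : X ⟶ Y) (q : ℕ) (U' : Y.Opens)
    (V' : X.Opens) (h : V' = f ⁻¹ᵁ U')
    (H : ∀ a : Γ(X, f ⁻¹ᵁ U'), ∃ b : Γ(Y, U'), f.app U' b = a ^ q) :
    ∀ a : Γ(X, V'), ∃ b : Γ(Y, U'), f.appLE U' V' h.le b = a ^ q := by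
  subst h
  simpa [Scheme.Hom.appLE_eq_app] using H

/-- Transport of the exponent condition along an equality of opens `V' = f ⁻¹ V`, from `f.appLE`
to `f.app`. [folklore] -/
theorem SoloBlind.exponent_app_of_eq {X Y : Scheme.{u}} (f : X ⟶ Y) (q : ℕ) (U' : Y.Opens)
    (V' : X.Opens) (h : V' = f ⁻¹ᵁ U')
    (H : ∀ a : Γ(X, V'), ∃ b : Γ(Y, U'), f.appLE U' V' h.le b = a ^ q) :
    ∀ a : Γ(X, f ⁻¹ᵁ U'), ∃ b : Γ(Y, U'), f.app U' b = a ^ q := by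
  subst h
  simpa [Scheme.Hom.appLE_eq_app] using H

/-- **The exponent condition for a restriction.** `f ∣_ U` is purely inseparable of exponent `q`
iff for every open `V ≤ U` of the target every section of `X` over `f ⁻¹ V` has its `q`-th power
in the image of `f.app V`. [folklore] -/
theorem SoloBlind.exponent_morphismRestrict_iff {X Y : Scheme.{u}} (f : X ⟶ Y) (q : ℕ)
    (U : Y.Opens) :
    IsPurelyInseparableOfExponent q (f ∣_ U) ↔
      ∀ V : Y.Opens, V ≤ U → ∀ a : Γ(X, f ⁻¹ᵁ V), ∃ b : Γ(Y, V), f.app V b = a ^ q := by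
  constructor
  · intro H V hVU
    have hV : U.ι ''ᵁ (U.ι ⁻¹ᵁ V) = V := by
      rw [Scheme.Hom.image_preimage_eq_opensRange_inf, Scheme.Opens.opensRange_ι,
        inf_eq_right.mpr hVU]
    have H' := SoloBlind.exponent_app_of_eq f q (U.ι ''ᵁ (U.ι ⁻¹ᵁ V)) _
      (image_morphismRestrict_preimage f U (U.ι ⁻¹ᵁ V)) (by
        intro a
        obtain ⟨b, hb⟩ := H (U.ι ⁻¹ᵁ V) a
        rw [morphismRestrict_app'] at hb
        exact ⟨b, hb⟩)
    rwa [hV] at H'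
  · intro H O a
    rw [morphismRestrict_app']
    exact SoloBlind.exponent_appLE_of_eq f q (U.ι ''ᵁ O) _
      (image_morphismRestrict_preimage f U O) (H _ (U.ι_image_le O)) a

/-- The exponent condition over an open `V` of the target passes to every smaller open
`U ≤ V`. [folklore] -/
theorem SoloBlind.exponent_morphismRestrict_of_le {X Y : Scheme.{u}} (f : X ⟶ Y) (q : ℕ)
    {U V : Y.Opens} (e : U ≤ V) (h : IsPurelyInseparableOfExponent q (f ∣_ V)) :
    IsPurelyInseparableOfExponent q (f ∣_ U) := by
  rw [SoloBlind.exponent_morphismRestrict_iff] at h ⊢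
  exact fun W hWU => h W (hWU.trans e)

/-- If `f` is an isomorphism over an open `V` of the target, it is one over every smaller open
`U ≤ V` (base change along `U ↪ V`). [folklore] -/
theorem SoloBlind.isIso_morphismRestrict_of_le {X Y : Scheme.{u}} (f : X ⟶ Y) {U V : Y.Opens}
    (e : U ≤ V) [IsIso (f ∣_ V)] : IsIso (f ∣_ U) := by
  have sq : IsPullback (X.homOfLE (f.preimage_mono e)) (f ∣_ U) (f ∣_ V) (Y.homOfLE e) := by
    refine IsPullback.of_right (h₁₂ := (f ⁻¹ᵁ V).ι) (h₂₂ := V.ι) ?_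
      (morphismRestrict_homOfLE f U V e).symm (isPullback_morphismRestrict f V).flip
    simpa only [Scheme.homOfLE_ι] using (isPullback_morphismRestrict f U).flip
  have : (MorphismProperty.isomorphisms Scheme.{u}) (f ∣_ U) :=
    MorphismProperty.of_isPullback sq ((MorphismProperty.isomorphisms.iff _).mpr ‹_›)
  exact (MorphismProperty.isomorphisms.iff _).mp this

/-! ## Lemma R -/

/-- **Lemma R** (`SoloBlind.ResolveStep` holds): composing a purely inseparable alteration of
exponent `q` between integral schemes with a resolution of singularities of its source gives a
purely inseparable alteration of exponent `q` with integral source. The open of finiteness and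
exponent `q` is `U ∖ ρ(Z ∖ V)` (`U` that of `ρ`, `V` the isomorphism locus of `σ`); it contains
the generic point of `X`. [cite: Temkin2013, §1 p. 3 (i) ⊂ (iii)] [cite: DeJong1996, 2.20] -/
theorem SoloBlind.ResolveStep_holds : SoloBlind.ResolveStep.{u} := by
  intro X Z Z' ρ σ q hX hZ hρ hσ
  haveI : IsReduced Z' := hσ.isRegular.isReduced
  haveI hZ' : IsIntegral Z' := hσ.isBirational.isIntegral
  obtain ⟨hρP, hρS, U, hU, hUfin, hUexp⟩ := hρ
  haveI := hρP
  haveI := hρS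
  haveI := hUfin
  haveI := hσ.isProper
  haveI : Surjective σ := hσ.isPurelyInseparableAlteration.surjective
  obtain ⟨V, hV, -, hViso⟩ := hσ.isBirational
  haveI := hViso
  refine ⟨hZ', inferInstance, inferInstance, ?_⟩
  -- the closed set of `X` over which `ρ⁻¹` leaves the isomorphism locus `V` of `σ`
  have hC : IsClosed (ρ '' (V : Set Z)ᶜ) := ρ.isClosedMap _ V.isOpen.isClosed_compl
  let W : X.Opens := ⟨(U : Set X) \ ρ '' (V : Set Z)ᶜ, U.isOpen.sdiff hC⟩
  have hWU : W ≤ U := fun _ hx => hx.1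
  have hWV : ρ ⁻¹ᵁ W ≤ V := by
    intro x hx
    by_contra hxV
    exact hx.2 ⟨x, hxV, rfl⟩
  -- the generic point of `X` lies in `W`
  have hηU : genericPoint X ∈ U :=
    ((genericPoint_spec X).mem_open_set_iff U.isOpen).mpr (by simpa using hU.nonempty)
  have hηW : genericPoint X ∈ W := by
    refine ⟨hηU, ?_⟩
    rintro ⟨z, hzV, hz⟩
    have hzU : z ∈ ρ ⁻¹ᵁ U := by
      show ρ z ∈ U
      rw [hz]
      exact hηU
    have := eq_genericPoint_of_isFinite_restrict ρ U hzU hz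
    apply hzV
    rw [this]
    exact ((genericPoint_spec Z).mem_open_set_iff V.isOpen).mpr (by simpa using hV.nonempty)
  refine ⟨W, W.isOpen.dense ⟨_, hηW⟩, ?_, ?_⟩
  · -- finiteness over `W`
    rw [morphismRestrict_comp]
    haveI : IsIso (σ ∣_ ρ ⁻¹ᵁ W) := SoloBlind.isIso_morphismRestrict_of_le σ hWV
    haveI : IsFinite (σ ∣_ ρ ⁻¹ᵁ W) := MorphismProperty.of_isIso @IsFinite _
    exact MorphismProperty.comp_mem _ _ _ ‹IsFinite (σ ∣_ ρ ⁻¹ᵁ W)›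
      (isFinite_morphismRestrict_of_le ρ hWU)
  · -- exponent `q` over `W`
    rw [morphismRestrict_comp]
    haveI : IsIso (σ ∣_ ρ ⁻¹ᵁ W) := SoloBlind.isIso_morphismRestrict_of_le σ hWV
    have h1 : IsPurelyInseparableOfExponent 1 (σ ∣_ ρ ⁻¹ᵁ W) :=
      SoloBlind.exponent_one_of_isIso _
    have h2 : IsPurelyInseparableOfExponent q (ρ ∣_ W) :=
      SoloBlind.exponent_morphismRestrict_of_le ρ q hWU hUexp
    simpa using SoloBlind.exponent_comp h1 h2

end Summit.ResolutionOfSingularities.ResolutionOfSingularities.Theorems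

end
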